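/-
Copyright (c) 2026. All rights reserved.
Released under Apache 2.0 license as described in the file LICENSE.
Authors: abc-iut cell, wave-2 discharge seat abc-iut-L6-t6 (proof-only companion of abc-iut-L6-t4's
`VerticallyCoricLGP.lean`).
-/
import Literature.IUT.LogThetaLattice.VerticallyCoricLGP

/-!
# [IUTchIII] Proposition 3.5: what the typed form proves by itself (proof-only companion)

Proof-only companion (DISCHARGE-L6 §E2, LIST C item C1) of
`Literature/IUT/LogThetaLattice/VerticallyCoricLGP.lean` (seat abc-iut-L6-t4, p403950), which types
S. Mochizuki, *Inter-universal Teichmüller Theory III*, kurims manuscript (May 2020), Proposition 3.5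
pp. 103–106 [claim key Mochizuki2012, status disputed, D-0012] STATEMENTS-FIRST: part (i) as the OUTPUT
SIGNATURE `VerticallyCoricLGPData` (named outputs of the printed "functorial algorithm … for
constructing" the vertically coric local LGP-monoids and their Kummer isomorphisms), part (ii) (a), (b),
(c) and the concluding "log-Kummer correspondence" as `Prop`-valued definitions over abstract data.

Outcome of the discharge pass, per printed sub-item (DISCHARGE-L6 §E2 vocabulary):

* (i) — NEEDS. A construction; its inputs are other seats' REAL objects (the monoids `Ψ_cns(𝔉_≻)` and
  Kummer isomorphisms of [IUTchII] Cor. 4.5 (iii) / 4.6 (iii): abc-iut-L6-t2; the log-links and the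
  vertical coricity of [IUTchIII] Def. 1.1 / Thm. 1.5 (i): abc-iut-L6-t3; the 𝒟-Θ^{±ell}NF-Hodge theaters:
  abc-iut-L5-t4). What the typed signature proves by itself is recorded here: it is SATISFIABLE over any
  ambient rings (`nonempty_verticallyCoricLGPData` — the trivial monoids with the unique isomorphisms
  between them), i.e. the signature carries no propositional content of its own; all content lies in
  WHICH monoids the construction plugs in.
* (ii) (a), (b), (c) — SLOT. `Prop35ii_a`, `Prop35ii_b`, `Prop35ii_c` are predicates on abstract data
  (shells, Kummer maps, log-iterates as partial maps, the relation "related via the log-link"); nothing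
  to prove before the merge.
* (ii), final paragraph p. 106, "Thus, one obtains a sort of 'log-Kummer correspondence' … which is
  invariant with respect to the translation symmetries … of the `n`-th column" — PROVED as typed: the
  translation-invariance conjunct of `logKummerCorrespondence` holds for every `ℤ`-indexed family (the
  parent file's `iUnion_range_shift`), so the named statement is EQUIVALENT to its action clause
  (`logKummerCorrespondence_iff`), and it FOLLOWS from (ii) (c) as typed, whose first conjunct is that
  action clause (`logKummerCorrespondence_of_prop35ii_c`) — the printed "Thus".

No new definitions. Nothing in this file bears on the disputed [IUTchIII] Cor. 3.12.
-/

namespace Literature.IUT.LogThetaLattice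

universe u v w

/-! ## Proposition 3.5 (i): the output signature is satisfiable (junk-instance test, recorded) -/

/-- The OUTPUT SIGNATURE of [IUTchIII] Proposition 3.5 (i) (pp. 103–104) is satisfiable over ANY
ambient rings: all monoids trivial, the Kummer isomorphisms the unique isomorphisms of trivial
monoids. Recorded to document that `VerticallyCoricLGPData` is a pure signature (per-item outcome
NEEDS: the printed construction is owed after the merge with the owners' real objects), not a claim.
[cite: Mochizuki2012, III Prop 3.5 (i) p.103] -/
theorem nonempty_verticallyCoricLGPData (lstar : ℕ) (V : Type v) (isBad : V → Prop)
    (R : V → Fin lstar → Type u) [∀ v j, CommRing (R v j)]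
    (Rm : ℤ → V → Fin lstar → Type u) [∀ m v j, CommRing (Rm m v j)] :
    Nonempty (VerticallyCoricLGPData lstar V isBad R Rm) := by
  have triv : ∀ (A B : Type u) [CommRing A] [CommRing B],
      Nonempty ((⊥ : Submonoid A) ≃* (⊥ : Submonoid B)) := fun A B _ _ =>
    ⟨{ toFun := fun _ => 1
       invFun := fun _ => 1
       left_inv := fun x => Subtype.ext ((Submonoid.mem_bot.mp x.2).symm)
       right_inv := fun y => Subtype.ext ((Submonoid.mem_bot.mp y.2).symm)
       map_mul' := fun _ _ => (mul_one _).symm }⟩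
  exact
    ⟨{ Ψcoric := fun _ _ => ⊥
       ΨcoricInf := fun _ _ => ⊥
       ΨF := fun _ _ _ => ⊥
       ΨFInf := fun _ _ _ => ⊥
       kummer := fun m v j => Classical.choice (triv (Rm m v j) (R v j))
       kummerInf := fun m v j => Classical.choice (triv (Rm m v j) (R v j))
       ΨcoricSplit := fun _ _ _ => ⊥
       coricSplit_le := fun _ _ _ => le_rfl }⟩

/-! ## Proposition 3.5 (ii): the log-Kummer correspondence reduces to its action clause and follows from (c) -/

/-- The named statement `logKummerCorrespondence` ([IUTchIII] Prop. 3.5 (ii), final paragraph, p. 106)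
is EQUIVALENT to its action clause "the groups of units and splitting monoids act on `𝓘^ℚ`": the
translation-invariance conjunct holds for every `ℤ`-indexed family of Kummer maps
(`iUnion_range_shift`). [cite: Mochizuki2012, III Prop 3.5 (ii) p.106] -/
theorem logKummerCorrespondence_iff {R : Type u} [CommRing R] (IQ : Submodule ℤ R) (M : ℤ → Type w)
    [∀ m, Monoid (M m)] (κ : ∀ m, M m →* R) :
    logKummerCorrespondence IQ M κ ↔ ∀ m (x : M m), ∀ a ∈ IQ, κ m x * a ∈ IQ :=
  ⟨fun h => h.1, fun h => ⟨h, iUnion_range_shift M fun m => ⇑(κ m)⟩⟩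

/-- "**Thus**, one obtains a sort of 'log-Kummer correspondence'" (p. 106 l. 25): as typed,
Proposition 3.5 (ii) (c) (Bad Primes: the splitting monoids act on `𝓘^ℚ` through their Kummer images,
compatibly up to roots of unity along the log-links) IMPLIES the log-Kummer correspondence statement —
its action clause is the first conjunct of (c) and its translation-invariance clause is automatic.
PROVED. [cite: Mochizuki2012, III Prop 3.5 (ii) p.106] -/
theorem logKummerCorrespondence_of_prop35ii_c {R : Type u} [CommRing R] (IQ : Submodule ℤ R)
    (M : ℤ → Type w) [∀ m, Monoid (M m)] (κ : ∀ m, M m →* R)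
    (Rel : ∀ m, M m → M (m + 1) → Prop) (h : Prop35ii_c IQ M κ Rel) :
    logKummerCorrespondence IQ M κ :=
  (logKummerCorrespondence_iff IQ M κ).mpr h.1

/-- Conversely the action clause of the log-Kummer correspondence is exactly the first conjunct of
(ii) (c); what (c) adds is the root-of-unity compatibility along the log-links (p. 106 l. 1–7, "the only
portions of these actions that are possibly related to one another via these log-links are the
indeterminacies with respect to multiplication by roots of unity"). [cite: Mochizuki2012, III Prop 3.5 (ii) p.106] -/
theorem prop35ii_c_iff {R : Type u} [CommRing R] (IQ : Submodule ℤ R) (M : ℤ → Type w)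
    [∀ m, Monoid (M m)] (κ : ∀ m, M m →* R) (Rel : ∀ m, M m → M (m + 1) → Prop) :
    Prop35ii_c IQ M κ Rel ↔
      logKummerCorrespondence IQ M κ ∧
        ∀ m (x : M m) (y : M (m + 1)), Rel m x y →
          ∃ ζ : R, (∃ k : ℕ, 0 < k ∧ ζ ^ k = 1) ∧ κ (m + 1) y = ζ * κ m x := by
  rw [logKummerCorrespondence_iff]
  rfl

end Literature.IUT.LogThetaLattice
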